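import Mathlib
import HarnessLib
import Summits.CriticalPhenomena.PercolationContinuityZ3.Theses.PercTreeValue
import Summits.CriticalPhenomena.PercolationContinuityZ3.Theorems.PercTreeValueTetrahedronDisjointCoexistenceStubShellOfSixWalls
import Summits.CriticalPhenomena.PercolationContinuityZ3.Theorems.PercTreeValueTetrahedronDisjointCoexistenceStubShiftBoxCrossing
import Literature.Probability.Percolation.LatticeWalksGM
import Literature.Probability.Percolation.PlanarDuality
import Literature.Probability.Percolation.RSW

/-!
# `stub_tiledShell` of line `Sketch` (crux `TetrahedronDisjointCoexistence`,
# stmt-CriticalPhenomena-7798): the tiled closed shell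

Registered stub `stub_tiledShell` (T1, rev c2) of the lead's skeleton
`Cruxes/TetrahedronDisjointCoexistence/Lines/Sketch.lean`, landed DEF-FREE over tree declarations.

Fix `p`, a tile radius `s` and `c ≥ 0` with `P_p(X_B event at scale s) ≤ 1 - c`, where the X_B
event is "some vertex of `B(s)` is joined inside `B(2s)` to a vertex of `∂B(2s)`". Let `R, R'` be
vertex sets of `ℤ³` and `J` a finite set of tile centres such that every vertex `u ∈ R' ∖ R`
adjacent to `R` lies in a tile `v + B(s)`, `v ∈ J`, whose doubled tile has room: every lattice
neighbour of `v + B(2s)` lies in `R'`. Then `c ^ |J| ≤ P_p(Shell(R, R'))`, where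
`Shell(R, R')` = "no open path of `R' ∖ R` from a vertex adjacent to `R` to a vertex adjacent to
`R'ᶜ`".

Proof.
* For `v ∈ ℤ³` let `E_v` be the `v`-translate of the X_B event (literally the event of
  `stub_shiftBoxCrossing`, so `P(E_v) = P(X_B) ≤ 1 - c` and `P(E_vᶜ) ≥ c`).
* Pointwise, on lattice configurations `ω ⊆ E(ℤ³)`: an open path of `R' ∖ R` from `u` (adjacent
  to `R`) to `w` (adjacent to some `z' ∉ R'`) starts in some `v + B(s)`, `v ∈ J` (`hcover`), and
  `w ∉ v + B(2s)` (room). Clipping the path at its first visit to sup-distance `2s` from `v`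
  (`exists_openConnIn_le_level` for the `1`-Lipschitz function `x ↦ ‖x - v‖_∞`) realises `E_v`.
  Hence `⋂_{v ∈ J} E_vᶜ ⊆ Shell(R, R')` a.e. (`sixWalls_real_mono_of_subset_edgeSet`).
* The `E_v` are increasing and measurable, so Harris–FKG for the finitely many decreasing
  complements (`sixWalls_prod_real_le_biInter`) gives `c ^ |J| ≤ ∏_{v ∈ J} P(E_vᶜ) ≤ P(⋂ E_vᶜ)`.
-/

noncomputable section

namespace Summit.CriticalPhenomena.PercolationContinuityZ3.Theorems.TetrahedronDisjointCoexistence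

open MeasureTheory
open Literature.Probability.Percolation Literature.Probability.LatticeModels

/-! ### Sup-distance geometry of `ℤ³` -/

/-- The sup-distance to `v` is `1`-Lipschitz along the edges of `ℤ³`. -/
theorem tiledShell_supDist_le_of_adj (v : Site 3) :
    ∀ x y : Site 3, (zdGraph 3).Adj x y →
      max (max |y 0 - v 0| |y 1 - v 1|) |y 2 - v 2| ≤
        max (max |x 0 - v 0| |x 1 - v 1|) |x 2 - v 2| + 1 := by
  intro x y h
  have h0 := zdGraph_adj_apply_le h 0
  have h1 := zdGraph_adj_apply_le h 1
  have h2 := zdGraph_adj_apply_le h 2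
  simp only [abs_eq_max_neg]
  omega

/-- A vertex of `v + B(n)` is at sup-distance at most `n` from `v`. -/
theorem tiledShell_supDist_le_of_mem_box {v x : Site 3} {n : ℕ}
    (h : x - v ∈ box 3 n) :
    max (max |x 0 - v 0| |x 1 - v 1|) |x 2 - v 2| ≤ (n : ℤ) := by
  rw [mem_box] at h
  have h0 := h 0
  have h1 := h 1
  have h2 := h 2
  simp only [Pi.sub_apply] at h0 h1 h2
  simp only [abs_eq_max_neg]
  omega

/-- A vertex at sup-distance at most `n` from `v` lies in `v + B(n)`. -/
theorem tiledShell_mem_box_of_supDist_le {v x : Site 3} {n : ℕ}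
    (h : max (max |x 0 - v 0| |x 1 - v 1|) |x 2 - v 2| ≤ (n : ℤ)) :
    x - v ∈ box 3 n := by
  rw [mem_box]
  intro i
  simp only [abs_eq_max_neg] at h
  simp only [Pi.sub_apply]
  fin_cases i <;> simp <;> omega

/-- A vertex outside `v + B(n)` is at sup-distance more than `n` from `v`. -/
theorem tiledShell_lt_supDist_of_not_mem_box {v x : Site 3} {n : ℕ}
    (h : x - v ∉ box 3 n) :
    (n : ℤ) < max (max |x 0 - v 0| |x 1 - v 1|) |x 2 - v 2| := by
  by_contra hle
  exact h (tiledShell_mem_box_of_supDist_le (not_lt.1 hle))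

/-- A vertex whose `i`-th coordinate exceeds that of `v` by exactly `n` has a lattice neighbour
outside `v + B(n)` (namely `y + eᵢ`). -/
theorem tiledShell_exit_of_eq_pos {v y : Site 3} {n : ℕ} (i : Fin 3) (h : y i - v i = (n : ℤ)) :
    ∃ z : Site 3, z - v ∉ box 3 n ∧ (zdGraph 3).Adj y z := by
  refine ⟨y + Pi.single i 1, ?_, (zdGraph_adj_iff _ _).2 ⟨i, Or.inl rfl⟩⟩
  rw [mem_box, not_forall]
  refine ⟨i, ?_⟩
  simp only [Pi.sub_apply, Pi.add_apply, Pi.single_eq_same]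
  omega

/-- A vertex whose `i`-th coordinate is below that of `v` by exactly `n` has a lattice neighbour
outside `v + B(n)` (namely `y - eᵢ`). -/
theorem tiledShell_exit_of_eq_neg {v y : Site 3} {n : ℕ} (i : Fin 3) (h : y i - v i = -(n : ℤ)) :
    ∃ z : Site 3, z - v ∉ box 3 n ∧ (zdGraph 3).Adj y z := by
  refine ⟨y - Pi.single i 1, ?_, (zdGraph_adj_iff _ _).2 ⟨i, Or.inr (sub_add_cancel y _).symm⟩⟩
  rw [mem_box, not_forall]
  refine ⟨i, ?_⟩
  simp only [Pi.sub_apply, Pi.single_eq_same]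
  omega

/-- A vertex at sup-distance exactly `n` from `v` has a lattice neighbour outside `v + B(n)`. -/
theorem tiledShell_exit_of_supDist_eq {v y : Site 3} {n : ℕ}
    (h : max (max |y 0 - v 0| |y 1 - v 1|) |y 2 - v 2| = (n : ℤ)) :
    ∃ z : Site 3, z - v ∉ box 3 n ∧ (zdGraph 3).Adj y z := by
  have hcase : y 0 - v 0 = (n : ℤ) ∨ y 0 - v 0 = -(n : ℤ) ∨ y 1 - v 1 = (n : ℤ) ∨
      y 1 - v 1 = -(n : ℤ) ∨ y 2 - v 2 = (n : ℤ) ∨ y 2 - v 2 = -(n : ℤ) := by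
    simp only [abs_eq_max_neg] at h
    omega
  rcases hcase with h0 | h0 | h1 | h1 | h2 | h2
  · exact tiledShell_exit_of_eq_pos 0 h0
  · exact tiledShell_exit_of_eq_neg 0 h0
  · exact tiledShell_exit_of_eq_pos 1 h1
  · exact tiledShell_exit_of_eq_neg 1 h1
  · exact tiledShell_exit_of_eq_pos 2 h2
  · exact tiledShell_exit_of_eq_neg 2 h2

/-! ### The translated X_B events -/

/-- The translated annulus-crossing event `E_v` is increasing. -/
theorem tiledShell_isUpperSet_event (v : Site 3) (s : ℕ) :
    IsUpperSet {ω : BondConfig (Site 3) | ∃ x : Site 3, x - v ∈ box 3 s ∧ ∃ y : Site 3,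
        y - v ∈ box 3 (2 * s) ∧ (∃ z : Site 3, z - v ∉ box 3 (2 * s) ∧ (zdGraph 3).Adj y z) ∧
          ω ∈ openConnIn {u : Site 3 | u - v ∈ box 3 (2 * s)} x y} := by
  rintro ω ω' hle ⟨x, hx, y, hy, hz, hω⟩
  exact ⟨x, hx, y, hy, hz, isUpperSet_openConnIn _ x y hle hω⟩

/-- The translated annulus-crossing event `E_v` is measurable (a countable union of the
measurable events `{x ↔ y in v + B(2s)}`). -/
theorem tiledShell_measurableSet_event (v : Site 3) (s : ℕ) :
    MeasurableSet {ω : BondConfig (Site 3) | ∃ x : Site 3, x - v ∈ box 3 s ∧ ∃ y : Site 3,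
        y - v ∈ box 3 (2 * s) ∧ (∃ z : Site 3, z - v ∉ box 3 (2 * s) ∧ (zdGraph 3).Adj y z) ∧
          ω ∈ openConnIn {u : Site 3 | u - v ∈ box 3 (2 * s)} x y} := by
  have h : {ω : BondConfig (Site 3) | ∃ x : Site 3, x - v ∈ box 3 s ∧ ∃ y : Site 3,
        y - v ∈ box 3 (2 * s) ∧ (∃ z : Site 3, z - v ∉ box 3 (2 * s) ∧ (zdGraph 3).Adj y z) ∧
          ω ∈ openConnIn {u : Site 3 | u - v ∈ box 3 (2 * s)} x y} =
      ⋃ x : Site 3, ⋃ y : Site 3, ⋃ (_ : x - v ∈ box 3 s ∧ y - v ∈ box 3 (2 * s) ∧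
          (∃ z : Site 3, z - v ∉ box 3 (2 * s) ∧ (zdGraph 3).Adj y z)),
        (openConnIn {u : Site 3 | u - v ∈ box 3 (2 * s)} x y : Set (BondConfig (Site 3))) := by
    ext ω
    simp only [Set.mem_setOf_eq, Set.mem_iUnion, exists_prop]
    constructor
    · rintro ⟨x, hx, y, hy, hz, hω⟩
      exact ⟨x, y, ⟨hx, hy, hz⟩, hω⟩
    · rintro ⟨x, y, ⟨hx, hy, hz⟩, hω⟩
      exact ⟨x, hx, y, hy, hz, hω⟩
  rw [h]
  exact MeasurableSet.iUnion fun x => MeasurableSet.iUnion fun y =>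
    MeasurableSet.iUnion fun _ => restrictProduct_measurableSet_openConnIn _ x y

/-- `P(E_vᶜ) ≥ c` whenever `P(X_B) ≤ 1 - c` (translation invariance, `stub_shiftBoxCrossing`). -/
theorem tiledShell_le_real_compl_event (p : unitInterval) (s : ℕ) (c : ℝ)
    (hXB : (bondPercolation (zdGraph 3) p).real
        {ω | ∃ x ∈ box 3 s, ∃ y ∈ innerBoundary (zdGraph 3) (box 3 (2 * s)),
          ω ∈ openConnIn ↑(box 3 (2 * s)) x y} ≤ 1 - c) (v : Site 3) :
    c ≤ (bondPercolation (zdGraph 3) p).real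
        {ω : BondConfig (Site 3) | ∃ x : Site 3, x - v ∈ box 3 s ∧ ∃ y : Site 3,
          y - v ∈ box 3 (2 * s) ∧ (∃ z : Site 3, z - v ∉ box 3 (2 * s) ∧ (zdGraph 3).Adj y z) ∧
            ω ∈ openConnIn {u : Site 3 | u - v ∈ box 3 (2 * s)} x y}ᶜ := by
  rw [probReal_compl_eq_one_sub (tiledShell_measurableSet_event v s), stub_shiftBoxCrossing p v s]
  linarith

/-! ### The pointwise heart: a shell crossing realises a translated X_B event -/

/-- **Pointwise.** On a lattice configuration `ω ⊆ E(ℤ³)`, an open path of `R' ∖ R` from a vertex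
`u` adjacent to `R` to a vertex `w` adjacent to `R'ᶜ` realises, for the tile centre `v ∈ J`
covering `u`, the translated X_B event `E_v`: `w ∉ v + B(2s)` (every neighbour of `v + B(2s)` lies
in `R'`), so the path clipped at its first visit to sup-distance `2s` from `v` joins
`u ∈ v + B(s)` inside `v + B(2s)` to a vertex with a neighbour outside `v + B(2s)`. -/
theorem tiledShell_event_of_openConnIn (s : ℕ) (R R' : Set (Site 3)) (J : Finset (Site 3))
    (hcover : ∀ u ∈ R' \ R, (∃ z ∈ R, (zdGraph 3).Adj u z) →
      ∃ v ∈ J, u - v ∈ box 3 s ∧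
        ∀ y : Site 3, y - v ∈ box 3 (2 * s) → ∀ z : Site 3, (zdGraph 3).Adj y z → z ∈ R')
    {ω : BondConfig (Site 3)} (hω : ω ⊆ (zdGraph 3).edgeSet) {u w : Site 3} (hu : u ∈ R' \ R)
    (huz : ∃ z ∈ R, (zdGraph 3).Adj u z) (hwz : ∃ z ∉ R', (zdGraph 3).Adj w z)
    (hconn : ω ∈ openConnIn (R' \ R) u w) :
    ∃ v ∈ J, ω ∈ {ω : BondConfig (Site 3) | ∃ x : Site 3, x - v ∈ box 3 s ∧ ∃ y : Site 3,
        y - v ∈ box 3 (2 * s) ∧ (∃ z : Site 3, z - v ∉ box 3 (2 * s) ∧ (zdGraph 3).Adj y z) ∧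
          ω ∈ openConnIn {u : Site 3 | u - v ∈ box 3 (2 * s)} x y} := by
  obtain ⟨v, hvJ, huv, hroom⟩ := hcover u hu huz
  refine ⟨v, hvJ, ?_⟩
  -- `w ∉ v + B(2s)`: otherwise its neighbour outside `R'` would lie in `R'`
  have hw : w - v ∉ box 3 (2 * s) := by
    intro hin
    obtain ⟨z', hz', hwz'⟩ := hwz
    exact hz' (hroom w hin z' hwz')
  -- clip the path at its first visit to sup-distance `2s` from `v`
  have hx : max (max |u 0 - v 0| |u 1 - v 1|) |u 2 - v 2| ≤ ((2 * s : ℕ) : ℤ) := by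
    have h1 := tiledShell_supDist_le_of_mem_box huv
    push_cast
    linarith [abs_nonneg (u 0 - v 0), le_max_left (max |u 0 - v 0| |u 1 - v 1|) |u 2 - v 2|,
      le_max_left |u 0 - v 0| |u 1 - v 1|]
  have hy : ((2 * s : ℕ) : ℤ) ≤ max (max |w 0 - v 0| |w 1 - v 1|) |w 2 - v 2| :=
    (tiledShell_lt_supDist_of_not_mem_box hw).le
  obtain ⟨y, hyf, hconn'⟩ := exists_openConnIn_le_level hω
    (fun x : Site 3 => max (max |x 0 - v 0| |x 1 - v 1|) |x 2 - v 2|)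
    (tiledShell_supDist_le_of_adj v) ((2 * s : ℕ) : ℤ) hx hy hconn
  have hsub : (R' \ R) ∩ {z : Site 3 | max (max |z 0 - v 0| |z 1 - v 1|) |z 2 - v 2| ≤ ((2 * s : ℕ) : ℤ)} ⊆
      {u : Site 3 | u - v ∈ box 3 (2 * s)} := fun z hz => tiledShell_mem_box_of_supDist_le hz.2
  exact ⟨u, huv, y, tiledShell_mem_box_of_supDist_le hyf.le, tiledShell_exit_of_supDist_eq hyf,
    openConnIn_mono hsub u y hconn'⟩

/-! ### The stub -/

/-- **T1 — the tiled closed shell.** Fix `p`, a tile radius `s` and `c ≥ 0` with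
`P_p(X_B event at scale s) ≤ 1 − c` (the event of `PercAnnulusCrossing.CritAnnulusNonCrossing` at
`n = s`). Let `R, R'` be vertex sets and `J` a finite set of tile centres such that every vertex
`u ∈ R' ∖ R` adjacent to `R` lies in a tile `v + B(s)`, `v ∈ J`, whose doubled tile has room:
every lattice neighbour of `v + B(2s)` lies in `R'`. Then `c ^ |J| ≤ P_p(Shell(R, R'))`,
`Shell(R, R')` = no open path of `R' ∖ R` from a vertex adjacent to `R` to a vertex adjacent to
`R'ᶜ`. Proof: a.e. `⋂_{v ∈ J} E_vᶜ ⊆ Shell(R, R')` for the translated X_B events `E_v`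
(`tiledShell_event_of_openConnIn`, `sixWalls_real_mono_of_subset_edgeSet`); the `E_v` are
increasing and measurable with `P(E_vᶜ) ≥ c` (`stub_shiftBoxCrossing`), and Harris–FKG for the
`|J|` decreasing complements (`sixWalls_prod_real_le_biInter`) gives `c ^ |J| ≤ P(⋂ E_vᶜ)`. -/
theorem stub_tiledShell (p : unitInterval) (s : ℕ) (c : ℝ) (hc : 0 ≤ c)
    (hXB : (bondPercolation (zdGraph 3) p).real
        {ω | ∃ x ∈ box 3 s, ∃ y ∈ innerBoundary (zdGraph 3) (box 3 (2 * s)),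
          ω ∈ openConnIn ↑(box 3 (2 * s)) x y} ≤ 1 - c)
    (R R' : Set (Site 3)) (J : Finset (Site 3))
    (hcover : ∀ u ∈ R' \ R, (∃ z ∈ R, (zdGraph 3).Adj u z) →
      ∃ v ∈ J, u - v ∈ box 3 s ∧
        ∀ y : Site 3, y - v ∈ box 3 (2 * s) → ∀ z : Site 3, (zdGraph 3).Adj y z → z ∈ R') :
    c ^ J.card ≤ (bondPercolation (zdGraph 3) p).real
        {ω | ∀ u ∈ R' \ R, ∀ w ∈ R' \ R, (∃ z ∈ R, (zdGraph 3).Adj u z) → (∃ z ∉ R', (zdGraph 3).Adj w z) →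
          ω ∉ openConnIn (R' \ R) u w} := by
  -- the translated X_B events
  set E : Site 3 → Set (BondConfig (Site 3)) := fun v =>
    {ω : BondConfig (Site 3) | ∃ x : Site 3, x - v ∈ box 3 s ∧ ∃ y : Site 3,
      y - v ∈ box 3 (2 * s) ∧ (∃ z : Site 3, z - v ∉ box 3 (2 * s) ∧ (zdGraph 3).Adj y z) ∧
        ω ∈ openConnIn {u : Site 3 | u - v ∈ box 3 (2 * s)} x y} with hE
  calc c ^ J.card = ∏ _v ∈ J, c := (Finset.prod_const c).symm
    _ ≤ ∏ v ∈ J, (bondPercolation (zdGraph 3) p).real (E v)ᶜ :=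
        Finset.prod_le_prod (fun _ _ => hc) fun v _ => tiledShell_le_real_compl_event p s c hXB v
    _ ≤ (bondPercolation (zdGraph 3) p).real (⋂ v ∈ J, (E v)ᶜ) :=
        sixWalls_prod_real_le_biInter (zdGraph 3) p J
          (fun v _ => (tiledShell_isUpperSet_event v s).compl)
          (fun v _ => (tiledShell_measurableSet_event v s).compl)
    _ ≤ _ := by
        refine sixWalls_real_mono_of_subset_edgeSet (zdGraph 3) p fun ω hω hmem => ?_
        intro u hu w _ huz hwz hconn
        obtain ⟨v, hvJ, hv⟩ := tiledShell_event_of_openConnIn s R R' J hcover hω hu huz hwz hconn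
        exact (Set.mem_iInter₂.1 hmem v hvJ) hv

end Summit.CriticalPhenomena.PercolationContinuityZ3.Theorems.TetrahedronDisjointCoexistence

end
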